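import Literature.Analysis.ValidatedNumerics.IntervalPolynomial
import Literature.NumberTheory.LFunctions.WeilTrigBrackets
import Mathlib.Analysis.Complex.Exponential
import Mathlib.Analysis.SpecialFunctions.Trigonometric.DerivHyp
import HarnessLib

/-!
# Twisted moment certificates, odd characters (I): a kernel-checkable polynomial approximation of `sech`

Cell `rh-explicit`, WEIL TRACK — GRH ARM (namespace `Summit.Ventures.WeilGRH`).  For an ODD character the
frequency weight of `Q_χ` exceeds the even one by the parity bonus `Re ψ(3/4+iτ/2) − Re ψ(1/4+iτ/2) = π sech(πτ)`,
whose contribution to `Re Q_χ(g)` is the position-space functional `∫ (g ⋆ g̃)(w) dw / (2 cosh(w/2))`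
(`Literature/…/WeilExplicitArchParitySech.lean`).  The moment-method certificate absorbs it EXACTLY (up to a
certified `ε`) by replacing `sech(w/2)` with a polynomial `P(w/2)` on `|w| ≤ 2a₀` and expanding
`∫ (g ⋆ g̃)(w) P(w/2) dw` in the moments of `g` (file `TwistedBonusMoments.lean`).  This file supplies the
approximation step for an ARBITRARY rational coefficient list `pc` (the certificate's data):

* rational list polynomials `addQ`, `smulQ`, `mulQ` mirroring `PolyMP.addR/smulR/mulR` of
  `IntervalPolynomial.lean`, their evaluation `evalQ pc x = PolyMP.evalR (pc.map (↑)) x`, `evalQ_mulQ`, the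
  absolute Horner bound `absHornerQ` with `abs_evalQ_le`;
* `coshCoeffsQ n` (the even Taylor coefficients `1/m!`, `m < n`) with `evalQ_coshCoeffsQ` and the remainder
  `abs_cosh_sub_evalQ_coshCoeffsQ_le` : `|cosh z − C_n(z)| ≤ |z|^n (n+1)/(n!·n)` for `|z| ≤ 1` (`Real.exp_bound`);
* **`abs_inv_cosh_sub_evalQ_le`**: for `|z| ≤ Z ≤ 1`,
  `|1/cosh z − P(z)| ≤ epsSechQ pc n Z := absHorner(P·C_n − 1, Z) + absHorner(P, Z)·Z^n (n+1)/(n!·n)`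
  (`1/cosh − P = (1 − P cosh)/cosh`, `cosh ≥ 1`), a RATIONAL the kernel evaluates — tiny when `pc` is the Taylor
  polynomial of `sech` and `n` exceeds its degree, by cancellation inside `P·C_n − 1`, which need not be proved.

Everything here is PROVED; no named facts.
-/

noncomputable section

open Finset

namespace Summit.Ventures.WeilGRH

open Literature.Analysis.ValidatedNumerics
open Literature.NumberTheory.LFunctions

/-! ## Rational coefficient lists -/

/-- Coefficientwise sum. [folklore] -/
def addQ : List ℚ → List ℚ → List ℚ
  | [], bs => bs
  | a :: as, [] => a :: as
  | a :: as, b :: bs => (a + b) :: addQ as bs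

/-- Scalar multiple. [folklore] -/
def smulQ (c : ℚ) (as : List ℚ) : List ℚ := as.map (c * ·)

/-- Product `(a + x·p)·q = a·q + x·(p·q)`. [folklore] -/
def mulQ : List ℚ → List ℚ → List ℚ
  | [], _ => []
  | a :: as, bs => addQ (smulQ a bs) (0 :: mulQ as bs)

/-- Real evaluation of a rational coefficient list (Horner, through `PolyMP.evalR`). [folklore] -/
def evalQ (as : List ℚ) (x : ℝ) : ℝ := PolyMP.evalR (as.map (fun q : ℚ ↦ (q : ℝ))) x

/-- `evalQ [] = 0`. [folklore] -/
@[simp] theorem evalQ_nil (x : ℝ) : evalQ [] x = 0 := rfl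

/-- Horner step of `evalQ`. [folklore] -/
@[simp] theorem evalQ_cons (a : ℚ) (as : List ℚ) (x : ℝ) : evalQ (a :: as) x = a + x * evalQ as x := rfl

/-- `addQ` commutes with the cast to real lists. [folklore] -/
theorem map_addQ : ∀ as bs : List ℚ,
    (addQ as bs).map (fun q : ℚ ↦ (q : ℝ)) = PolyMP.addR (as.map fun q : ℚ ↦ (q : ℝ)) (bs.map fun q : ℚ ↦ (q : ℝ))
  | [], bs => by simp [addQ, PolyMP.addR]
  | a :: as, [] => by simp [addQ, PolyMP.addR]
  | a :: as, b :: bs => by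
      simp only [addQ, List.map_cons, PolyMP.addR, Rat.cast_add, map_addQ as bs]

/-- `smulQ` commutes with the cast. [folklore] -/
theorem map_smulQ (c : ℚ) (as : List ℚ) :
    (smulQ c as).map (fun q : ℚ ↦ (q : ℝ)) = PolyMP.smulR (c : ℝ) (as.map fun q : ℚ ↦ (q : ℝ)) := by
  simp [smulQ, PolyMP.smulR, List.map_map, Function.comp_def]

/-- `mulQ` commutes with the cast. [folklore] -/
theorem map_mulQ : ∀ as bs : List ℚ,
    (mulQ as bs).map (fun q : ℚ ↦ (q : ℝ)) = PolyMP.mulR (as.map fun q : ℚ ↦ (q : ℝ)) (bs.map fun q : ℚ ↦ (q : ℝ))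
  | [], bs => by simp [mulQ, PolyMP.mulR]
  | a :: as, bs => by
      simp only [mulQ, map_addQ, map_smulQ, List.map_cons, map_mulQ as bs, PolyMP.mulR, Rat.cast_zero]

/-- `evalQ (addQ p q) = evalQ p + evalQ q`. [folklore] -/
theorem evalQ_addQ (as bs : List ℚ) (x : ℝ) : evalQ (addQ as bs) x = evalQ as x + evalQ bs x := by
  unfold evalQ; rw [map_addQ, PolyMP.evalR_addR]

/-- `evalQ (mulQ p q) = evalQ p · evalQ q`. [folklore] -/
theorem evalQ_mulQ (as bs : List ℚ) (x : ℝ) : evalQ (mulQ as bs) x = evalQ as x * evalQ bs x := by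
  unfold evalQ; rw [map_mulQ, PolyMP.evalR_mulR]

/-- Evaluation of a tabulated list `(List.range n).map f` is the plain sum `Σ_{k<n} f k x^k`. [folklore] -/
theorem evalQ_map_range (f : ℕ → ℚ) : ∀ (n : ℕ) (x : ℝ),
    evalQ ((List.range n).map f) x = ∑ k ∈ range n, (f k : ℝ) * x ^ k
  | 0, x => by simp [evalQ]
  | n + 1, x => by
      rw [List.range_succ_eq_map, List.map_cons, List.map_map, evalQ_cons, evalQ_map_range (f ∘ Nat.succ) n x,
        Finset.sum_range_succ', pow_zero, mul_one, Finset.mul_sum, add_comm]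
      congr 1
      refine Finset.sum_congr rfl fun k _ ↦ ?_
      simp only [Function.comp_apply, Nat.succ_eq_add_one, pow_succ]
      ring

/-- The Horner evaluation is the tree's plain power sum `polyR` (`WeilTrigBrackets.lean`). [folklore] -/
theorem evalQ_eq_polyR : ∀ (as : List ℚ) (x : ℝ), evalQ as x = polyR as x
  | [], x => by simp [evalQ, polyR]
  | a :: as, x => by
      rw [evalQ_cons, evalQ_eq_polyR as x]
      unfold polyR
      rw [List.length_cons, Finset.sum_range_succ', Finset.mul_sum]
      simp only [getV, List.getD_cons_succ, List.getD_cons_zero, pow_zero, mul_one, pow_succ]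
      rw [add_comm]
      congr 1
      exact Finset.sum_congr rfl fun k _ ↦ by ring

/-- `Σ_k |a_k| Z^k` in Horner form. [folklore] -/
def absHornerQ : List ℚ → ℚ → ℚ
  | [], _ => 0
  | a :: as, Z => |a| + Z * absHornerQ as Z

/-- `0 ≤ absHornerQ as Z` for `Z ≥ 0`. [folklore] -/
theorem absHornerQ_nonneg {Z : ℚ} (hZ : 0 ≤ Z) : ∀ as : List ℚ, 0 ≤ absHornerQ as Z
  | [] => le_rfl
  | _ :: as => add_nonneg (abs_nonneg _) (mul_nonneg hZ (absHornerQ_nonneg hZ as))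

/-- **Absolute bound** `|P(x)| ≤ absHorner(P, Z)` for `|x| ≤ Z`. [folklore] -/
theorem abs_evalQ_le {Z : ℚ} {x : ℝ} (hZ : 0 ≤ Z) (hx : |x| ≤ Z) :
    ∀ as : List ℚ, |evalQ as x| ≤ (absHornerQ as Z : ℝ)
  | [] => by simp [absHornerQ]
  | a :: as => by
      rw [evalQ_cons, absHornerQ]
      push_cast
      refine (abs_add_le _ _).trans (add_le_add le_rfl ?_)
      rw [abs_mul]
      have h := abs_evalQ_le hZ hx as
      have hZ0 : (0 : ℝ) ≤ (absHornerQ as Z : ℝ) := by exact_mod_cast absHornerQ_nonneg hZ as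
      exact mul_le_mul hx h (abs_nonneg _) (by exact_mod_cast hZ)

/-! ## The even Taylor polynomial of `cosh` -/

/-- Coefficient list of `C_n(z) = Σ_{m<n, m even} z^m/m!`. [folklore] -/
def coshCoeffsQ (n : ℕ) : List ℚ := (List.range n).map fun m ↦ if m % 2 = 0 then 1 / (m.factorial : ℚ) else 0

/-- `C_n(z) = (Σ_{m<n} z^m/m! + Σ_{m<n} (−z)^m/m!)/2`. [folklore] -/
theorem evalQ_coshCoeffsQ (n : ℕ) (z : ℝ) :
    evalQ (coshCoeffsQ n) z =
      ((∑ m ∈ range n, z ^ m / m.factorial) + ∑ m ∈ range n, (-z) ^ m / m.factorial) / 2 := by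
  unfold coshCoeffsQ
  rw [evalQ_map_range, ← Finset.sum_add_distrib, Finset.sum_div]
  refine Finset.sum_congr rfl fun m _ ↦ ?_
  rcases Nat.even_or_odd m with hm | hm
  · rw [if_pos (Nat.even_iff.1 hm), hm.neg_pow]; push_cast; field_simp; ring
  · rw [if_neg (by rw [Nat.odd_iff.1 hm]; decide), hm.neg_pow]; push_cast; ring

/-- **Taylor remainder of `cosh`**: `|cosh z − C_n(z)| ≤ |z|^n (n+1)/(n!·n)` for `|z| ≤ 1`, `n ≥ 1`. [folklore] -/
theorem abs_cosh_sub_evalQ_coshCoeffsQ_le {z : ℝ} (hz : |z| ≤ 1) {n : ℕ} (hn : 0 < n) :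
    |Real.cosh z - evalQ (coshCoeffsQ n) z| ≤ |z| ^ n * ((n.succ : ℝ) / (n.factorial * n)) := by
  rw [evalQ_coshCoeffsQ, Real.cosh_eq]
  have h1 := Real.exp_bound hz hn
  have h2 := Real.exp_bound (x := -z) (by rwa [abs_neg]) hn
  rw [abs_neg] at h2
  have e : (Real.exp z + Real.exp (-z)) / 2 -
      ((∑ m ∈ range n, z ^ m / m.factorial) + ∑ m ∈ range n, (-z) ^ m / m.factorial) / 2 =
      ((Real.exp z - ∑ m ∈ range n, z ^ m / m.factorial) +
        (Real.exp (-z) - ∑ m ∈ range n, (-z) ^ m / m.factorial)) / 2 := by ring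
  rw [e, abs_div, abs_two]
  have := abs_add_le (Real.exp z - ∑ m ∈ range n, z ^ m / m.factorial)
    (Real.exp (-z) - ∑ m ∈ range n, (-z) ^ m / m.factorial)
  linarith

/-! ## The approximation bound for `1/cosh` -/

/-- The rational error bound `absHorner(P·C_n − 1, Z) + absHorner(P, Z)·Z^n·(n+1)/(n!·n)`. [folklore] -/
def epsSechQ (pc : List ℚ) (n : ℕ) (Z : ℚ) : ℚ :=
  absHornerQ (addQ (mulQ pc (coshCoeffsQ n)) [-1]) Z +
    absHornerQ pc Z * (Z ^ n * (((n + 1 : ℕ) : ℚ) / ((n.factorial : ℚ) * n)))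

/-- **`|1/cosh z − P(z)| ≤ epsSechQ pc n Z`** for `|z| ≤ Z ≤ 1`, `n ≥ 1`, ANY rational list `pc`. [folklore] -/
theorem abs_inv_cosh_sub_evalQ_le (pc : List ℚ) {n : ℕ} (hn : 0 < n) {Z : ℚ} (hZ0 : 0 ≤ Z) (hZ1 : Z ≤ 1)
    {z : ℝ} (hz : |z| ≤ Z) : |1 / Real.cosh z - evalQ pc z| ≤ (epsSechQ pc n Z : ℝ) := by
  have hc : 1 ≤ Real.cosh z := Real.one_le_cosh z
  have hc0 : 0 < Real.cosh z := by linarith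
  have hz1 : |z| ≤ 1 := hz.trans (by exact_mod_cast hZ1)
  set P := evalQ pc z with hP
  set C := evalQ (coshCoeffsQ n) z with hC
  -- `1/cosh − P = (1 − P cosh)/cosh`, `|cosh| ≥ 1`
  have h1 : |1 / Real.cosh z - P| ≤ |P * Real.cosh z - 1| := by
    have e : 1 / Real.cosh z - P = -(P * Real.cosh z - 1) / Real.cosh z := by field_simp; ring
    rw [e, abs_div, abs_neg, abs_of_pos hc0]
    exact div_le_self (abs_nonneg _) hc
  -- `P cosh − 1 = (P C − 1) + P (cosh − C)`
  have h2 : |P * Real.cosh z - 1| ≤ |P * C - 1| + |P| * |Real.cosh z - C| := by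
    have e : P * Real.cosh z - 1 = (P * C - 1) + P * (Real.cosh z - C) := by ring
    rw [e]
    exact (abs_add_le _ _).trans (by rw [abs_mul])
  have h3 : |P * C - 1| ≤ (absHornerQ (addQ (mulQ pc (coshCoeffsQ n)) [-1]) Z : ℝ) := by
    have e : P * C - 1 = evalQ (addQ (mulQ pc (coshCoeffsQ n)) [-1]) z := by
      rw [evalQ_addQ, evalQ_mulQ, hP, hC, evalQ_cons, evalQ_nil]; push_cast; ring
    rw [e]; exact abs_evalQ_le hZ0 hz _
  have h4 : |P| ≤ (absHornerQ pc Z : ℝ) := abs_evalQ_le hZ0 hz pc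
  have h5 : |Real.cosh z - C| ≤ (Z : ℝ) ^ n * (((n + 1 : ℕ) : ℝ) / ((n.factorial : ℝ) * n)) := by
    refine (abs_cosh_sub_evalQ_coshCoeffsQ_le hz1 hn).trans ?_
    have : |z| ^ n ≤ (Z : ℝ) ^ n := pow_le_pow_left₀ (abs_nonneg _) hz n
    push_cast
    exact mul_le_mul_of_nonneg_right this (by positivity)
  have h6 : |P| * |Real.cosh z - C| ≤
      (absHornerQ pc Z : ℝ) * ((Z : ℝ) ^ n * (((n + 1 : ℕ) : ℝ) / ((n.factorial : ℝ) * n))) :=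
    mul_le_mul h4 h5 (abs_nonneg _) (by exact_mod_cast absHornerQ_nonneg hZ0 pc)
  unfold epsSechQ
  push_cast at h6 ⊢
  linarith [h1, h2, h3, h6]

/-- The same bound for the power-sum evaluation `polyR`. [folklore] -/
theorem abs_inv_cosh_sub_polyR_le (pc : List ℚ) {n : ℕ} (hn : 0 < n) {Z : ℚ} (hZ0 : 0 ≤ Z) (hZ1 : Z ≤ 1)
    {z : ℝ} (hz : |z| ≤ Z) : |1 / Real.cosh z - polyR pc z| ≤ (epsSechQ pc n Z : ℝ) := by
  rw [← evalQ_eq_polyR]; exact abs_inv_cosh_sub_evalQ_le pc hn hZ0 hZ1 hz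

/-- `0 ≤ epsSechQ` for `Z ≥ 0`. [folklore] -/
theorem epsSechQ_nonneg (pc : List ℚ) (n : ℕ) {Z : ℚ} (hZ : 0 ≤ Z) : 0 ≤ epsSechQ pc n Z := by
  unfold epsSechQ
  exact add_nonneg (absHornerQ_nonneg hZ _) (mul_nonneg (absHornerQ_nonneg hZ _) (by positivity))

end Summit.Ventures.WeilGRH

end
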